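import Literature.MathematicalPhysics.QuantumLattice.DuhamelTwoPoint
import Mathlib.Analysis.SpecialFunctions.Trigonometric.DerivHyp
import HarnessLib

/-!
# An explicit (hyperbolic) Falk–Bruch floor on the Duhamel two-point function

Topic `Literature/MathematicalPhysics/QuantumLattice` (sibling of `DuhamelTwoPoint.lean`, whose
objects it reuses verbatim: `Matrix.duhamel β H A B`, `Matrix.duhamelKernel β x y`,
`Matrix.gibbsState β H`, and the pair-sum representations `IsHermitian.re_gibbsState_sq`,
`IsHermitian.re_duhamel_self`, `IsHermitian.re_gibbsState_doubleComm`).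

For a Hermitian `H`, `β ≥ 0` and Hermitian observables `A_k` write, as in [DLS1978] §3,
`g = Σ_k ⟨A_k²⟩_β`, `b = Σ_k (A_k, A_k)_β` (Duhamel) and `c = Σ_k ⟨[A_k,[H,A_k]]⟩_β ≥ 0`.
Falk–Bruch's inequality [DLS1978, Thm. 3.1] is `b ≥ g · f(βc/4g)` with `f` the convex decreasing
function defined implicitly by `f(t tanh t) = t⁻¹ tanh t`. The tree so far carries only the weakened
consequence `g ≤ b + ½√(βbc)` (`Matrix.falkBruch_sum_le`, via `coth x ≤ 1 + 1/x`). This file proves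
the EXPLICIT floor

  `g² ≤ b · (g + βc/4)`, i.e. `b ≥ g²/(g + βc/4) = g/(1 + u)`, `u := βc/(4g)`

(`Matrix.falkBruch_sq_sum_le`, `Matrix.IsHermitian.sq_gibbsState_sq_le_duhamel_mul`,
`Matrix.IsHermitian.gibbsState_sq_sq_div_le_duhamel`), which is [DLS1978] Thm. 3.1 weakened only by
the elementary `f(u) ≥ 1/(1+u)` (equivalently `tanh t · (1 + t tanh t) ≥ t`, i.e. `sinh 2t ≥ 2t`):
it has the correct limits `1 − u` (`u → 0`) and `1/u` (`u → ∞`) of `f`, loses at most a factor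
`≈ 1.4` against `f` near `u ≈ 2`, and dominates the tree's weak form for every `u > 0`
(`1/(1+u) ≥ 2/(u + 2 + √(u² + 4u))`, the floor on `b/g` that `g ≤ b + ½√(βbc)` encodes).

The proof is the per-pair inequality "logarithmic mean × arithmetic mean ≥ geometric mean²" for the
Boltzmann weights `e^{-βEᵢ}`, `e^{-βEⱼ}` — the Duhamel kernel `K_β(Eᵢ,Eⱼ)` IS their logarithmic mean
(`Matrix.exp_half_sum_le_duhamelKernel`: `√(e^{-βx}e^{-βy}) ≤ K_β(x,y)`, from `sinh s ≥ s`) —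
combined with the identity `(wᵢ − wⱼ)² = β K c_{ij}` of `DuhamelTwoPoint.lean` and the Cauchy–Schwarz
inequality over pairs (Mathlib `Finset.sum_sq_le_sum_mul_sum_of_sq_le_mul`). No new definition, no
named fact.

Cell `pub/hubbard-tc` (D-0154 (1) thermal line, route «hubbard-tc-thermcert-1» K1: certified FLOORS on
the isothermal current response `(J_x, J_x)_β` are the instrument; hub-tc-therm-crit-1's triage of
packet v3 records that the tree's Falk–Bruch is only the weakened `falkBruch_sum_le` and that "the sharp
DLS Thm 3.1 f-form is absent"). WHAT THIS IS NOT: the sharp implicit `f`-form itself (convexity of `f`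
is not formalised here); any statement about the Hubbard model, a stiffness, or a temperature.

## References

* [DLS1978] F. J. Dyson, E. H. Lieb, B. Simon, *Phase transitions in quantum spin systems with
  isotropic and nonisotropic interactions*, J. Stat. Phys. **18** (1978) 335–383, §3, Thm. 3.1
  (`b ≥ g f(c/4g)`), eq. (35) (pair sums).
* H. Falk, L. W. Bruch, *Susceptibility and fluctuation*, Phys. Rev. **180** (1969) 442–444.
* [Carlson1972] B. C. Carlson, *The logarithmic mean*, Amer. Math. Monthly **79** (1972) 615–618
  (`√(ab) ≤ L(a,b) ≤ (a+b)/2` for the logarithmic mean `L`; the Duhamel kernel is `L(e^{-βx}, e^{-βy})`).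
-/

noncomputable section

open scoped Matrix.Norms.L2Operator ComplexOrder
open Finset MeasureTheory intervalIntegral

namespace Matrix

variable {n : Type*} [Fintype n] [DecidableEq n]

/-! ### Scalar lemmas: the Duhamel kernel is at least the geometric mean -/

/-- **Geometric mean ≤ logarithmic mean** for the Boltzmann weights: with `a = e^{-βx}`, `b = e^{-βy}`,
`√(ab) = e^{-β(x+y)/2} ≤ K_β(x,y)`. Proof: writing `-βx = μ + s`, `-βy = μ - s`, the identity
`a - b = β(y-x)K` reads `s·K = e^μ sinh s`, and `sinh s / s ≥ 1`. This is the classical inequality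
`G(a,b) ≤ L(a,b)` between the geometric and the logarithmic mean `L(a,b) = (a-b)/(log a - log b)`
(here `K_β(x,y) = L(e^{-βx}, e^{-βy})`). [cite: Carlson1972, eq. (2) (G ≤ L ≤ A)] [cite: DLS1978, eq. (35)] -/
theorem exp_half_sum_le_duhamelKernel (β x y : ℝ) :
    Real.exp (-(β * (x + y) / 2)) ≤ duhamelKernel β x y := by
  set μ : ℝ := -(β * (x + y) / 2) with hμ
  set s : ℝ := (β * y - β * x) / 2 with hs
  have hx : -(β * x) = μ + s := by rw [hμ, hs]; ring
  have hy : -(β * y) = μ - s := by rw [hμ, hs]; ring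
  have hK := duhamelKernel_pos β x y
  have hid := exp_sub_exp_eq_mul_duhamelKernel β x y
  -- `a - b = 2 e^μ sinh s` and `β (y - x) = 2 s`
  have hsinh : Real.exp (-(β * x)) - Real.exp (-(β * y)) = 2 * Real.exp μ * Real.sinh s := by
    rw [hx, hy, Real.sinh_eq, Real.exp_add, Real.exp_sub]
    have : Real.exp (-s) = (Real.exp s)⁻¹ := Real.exp_neg s
    rw [this]
    field_simp
  have h2s : β * (y - x) = 2 * s := by rw [hs]; ring
  rw [hsinh, h2s] at hid
  -- `hid : 2 e^μ sinh s = 2 s K`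
  have hsK : Real.exp μ * Real.sinh s = s * duhamelKernel β x y := by linarith
  have hμpos := Real.exp_pos μ
  rcases lt_trichotomy s 0 with hs0 | hs0 | hs0
  · -- `s < 0`: `sinh s ≤ s`, both sides negative
    have h1 : Real.sinh s ≤ s := Real.sinh_le_self_iff.2 hs0.le
    -- `e^μ sinh s = s K` and `e^μ sinh s ≤ e^μ s`, so `s K ≤ s e^μ`; divide by `s < 0`
    have h2 : s * duhamelKernel β x y ≤ s * Real.exp μ := by
      rw [← hsK, mul_comm s]
      exact mul_le_mul_of_nonneg_left h1 hμpos.le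
    nlinarith
  · -- `s = 0`: `βx = βy`, `K ≥ min(a,b) = a = e^μ`
    have hxy : β * x = β * y := by rw [hs] at hs0; linarith
    have hmin := min_exp_le_duhamelKernel β x y
    have ha : Real.exp (-(β * x)) = Real.exp μ := by
      rw [hμ, show β * (x + y) = β * x + β * y by ring, ← hxy]; ring_nf
    have hb : Real.exp (-(β * y)) = Real.exp μ := by rw [← hxy]; exact ha
    rw [ha, hb, min_self] at hmin
    exact hmin
  · -- `s > 0`: `s ≤ sinh s`
    have h1 : s ≤ Real.sinh s := Real.self_le_sinh_iff.2 hs0.le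
    have h2 : s * Real.exp μ ≤ s * duhamelKernel β x y := by
      rw [← hsK, mul_comm s]
      exact mul_le_mul_of_nonneg_left h1 hμpos.le
    nlinarith

/-- **Logarithmic mean × arithmetic mean ≥ geometric mean²**: with `a = e^{-βx}`, `b = e^{-βy}`,
`ab ≤ K_β(x,y) · (a+b)/2` (from `√(ab) ≤ K` and `√(ab) ≤ (a+b)/2`: `G² ≤ L·A` for the three means
of `a`, `b`). [cite: Carlson1972, eq. (2) (G ≤ L ≤ A)] [cite: DLS1978, eq. (35)] -/
theorem exp_mul_exp_le_duhamelKernel_mul_half_add (β x y : ℝ) :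
    Real.exp (-(β * x)) * Real.exp (-(β * y)) ≤
      duhamelKernel β x y * ((Real.exp (-(β * x)) + Real.exp (-(β * y))) / 2) := by
  have hG := exp_half_sum_le_duhamelKernel β x y
  set G : ℝ := Real.exp (-(β * (x + y) / 2)) with hGdef
  have hGpos : 0 < G := Real.exp_pos _
  -- `ab = G²`
  have hab : Real.exp (-(β * x)) * Real.exp (-(β * y)) = G * G := by
    rw [hGdef, ← Real.exp_add, ← Real.exp_add]
    congr 1
    ring
  -- `(a+b)/2 ≥ G` (AM–GM, as `(√a - √b)² ≥ 0` in the form `a + b - 2G = (e^{p} - e^{q})²`-free: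
  -- use `a = G e^{s}`, `b = G e^{-s}` and `e^{s} + e^{-s} ≥ 2`)
  set s : ℝ := (β * y - β * x) / 2 with hs
  have ha : Real.exp (-(β * x)) = G * Real.exp s := by
    rw [hGdef, ← Real.exp_add]; congr 1; rw [hs]; ring
  have hb : Real.exp (-(β * y)) = G * Real.exp (-s) := by
    rw [hGdef, ← Real.exp_add]; congr 1; rw [hs]; ring
  have hAM : G ≤ (Real.exp (-(β * x)) + Real.exp (-(β * y))) / 2 := by
    rw [ha, hb]
    have hcosh : 1 ≤ Real.cosh s := Real.one_le_cosh s
    rw [Real.cosh_eq] at hcosh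
    nlinarith
  rw [hab]
  exact mul_le_mul hG hAM hGpos.le (duhamelKernel_pos β x y).le

/-- **The per-pair hyperbolic Falk–Bruch inequality**: with `a = e^{-βx}`, `b = e^{-βy}`,
`K = K_β(x,y)` and the double-commutator pair weight `c = (y-x)(a-b)`,
`((a+b)/2)² ≤ K · ((a+b)/2 + (β/4)·c)`. Indeed `K·(β/4)c = (a-b)²/4` by `(a-b)² = βKc`
(`Matrix.sq_exp_sub_exp_eq`), so the claim is `ab ≤ K(a+b)/2`. For a two-level system this is
[DLS1978] Thm. 3.1 with `f(u) = tanh t/t` (`u = t tanh t`, `t = β(y-x)/2`) replaced by the smaller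
`1/(1+u)`. [cite: DLS1978, Thm. 3.1] -/
theorem sq_half_add_exp_le_duhamelKernel_mul (β x y : ℝ) :
    ((Real.exp (-(β * x)) + Real.exp (-(β * y))) / 2) ^ 2 ≤
      duhamelKernel β x y * ((Real.exp (-(β * x)) + Real.exp (-(β * y))) / 2 +
        β / 4 * ((y - x) * (Real.exp (-(β * x)) - Real.exp (-(β * y))))) := by
  have h1 := exp_mul_exp_le_duhamelKernel_mul_half_add β x y
  have h2 := sq_exp_sub_exp_eq β x y
  -- `K * (β/4 * c) = (a - b)^2 / 4`
  have h3 : duhamelKernel β x y * (β / 4 * ((y - x) * (Real.exp (-(β * x)) - Real.exp (-(β * y))))) =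
      (Real.exp (-(β * x)) - Real.exp (-(β * y))) ^ 2 / 4 := by
    rw [h2]; ring
  nlinarith [h3]

/-! ### The hyperbolic Falk–Bruch floor for Gibbs states of Hermitian matrices -/

section Spectral

variable {H : Matrix n n ℂ}

/-- **Falk–Bruch inequality, explicit hyperbolic form, for a finite family of Hermitian observables**:
with `g = Σ_k ⟨A_k²⟩_β`, `b = Σ_k (A_k, A_k)_β` and `c = Σ_k ⟨[A_k,[H,A_k]]⟩_β` (`β ≥ 0`),

  `g² ≤ b · (g + (β/4)·c)`.

Proof: in an eigenbasis of `H` all three are pair sums with the common weights `|a^k_{ij}|²`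
([DLS1978] (35)); per pair `((wᵢ+wⱼ)/2)² ≤ K_{ij}((wᵢ+wⱼ)/2 + (β/4)c_{ij})`
(`sq_half_add_exp_le_duhamelKernel_mul`); then Cauchy–Schwarz over (k, i, j). This is
[DLS1978] Thm. 3.1 `b ≥ g f(βc/4g)` weakened by `f(u) ≥ 1/(1+u)`; it implies the tree's
`falkBruch_sum_le` (`g ≤ b + ½√(βbc)`). [cite: DLS1978, Thm. 3.1] -/
theorem falkBruch_sq_sum_le (hH : H.IsHermitian) {β : ℝ} (hβ : 0 ≤ β) {ι : Type*} [Fintype ι]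
    {A : ι → Matrix n n ℂ} (hA : ∀ k, (A k).IsHermitian) :
    (∑ k, (gibbsState β H (A k * A k)).re) ^ 2 ≤
      (∑ k, (duhamel β H (A k) (A k)).re) *
        (∑ k, (gibbsState β H (A k * A k)).re +
          β / 4 * ∑ k, (gibbsState β H (A k * (H * A k - A k * H) - (H * A k - A k * H) * A k)).re) := by
  -- abbreviations (as in `falkBruch_sum_le`)
  set E := hH.eigenvalues with hE
  set W : n → ℝ := fun i => Real.exp (-(β * E i)) with hW
  set Zr : ℝ := ∑ i, W i with hZr
  set m : ι → n → n → ℝ := fun k i j => ‖(star (hH.eigenvectorUnitary : Matrix n n ℂ) * A k *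
    (hH.eigenvectorUnitary : Matrix n n ℂ)) i j‖ ^ 2 with hm
  set K : n → n → ℝ := fun i j => duhamelKernel β (E i) (E j) with hK
  set c : n → n → ℝ := fun i j => (E j - E i) * (W i - W j) with hc
  have hZr0 : 0 ≤ Zr := sum_nonneg fun i _ => (Real.exp_pos _).le
  have hm0 : ∀ k i j, 0 ≤ m k i j := fun k i j => sq_nonneg _
  have hK0 : ∀ i j, 0 ≤ K i j := fun i j => (duhamelKernel_pos β _ _).le
  have hc0 : ∀ i j, 0 ≤ c i j := fun i j => sub_mul_exp_sub_exp_nonneg hβ (E i) (E j)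
  have hW0 : ∀ i, 0 ≤ W i := fun i => (Real.exp_pos _).le
  have hmsymm : ∀ k i j, m k i j = m k j i := by
    intro k i j
    simp only [hm]
    rw [← star_apply_rotate (hA k) i j, norm_star]
  -- the three quantities as pair sums
  have hg : ∑ k, (gibbsState β H (A k * A k)).re = Zr⁻¹ * ∑ k, ∑ i, ∑ j, m k i j * W i := by
    rw [mul_sum]
    exact sum_congr rfl fun k _ => hH.re_gibbsState_sq (hA k) β
  have hb : ∑ k, (duhamel β H (A k) (A k)).re = Zr⁻¹ * ∑ k, ∑ i, ∑ j, m k i j * K i j := by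
    rw [mul_sum]
    exact sum_congr rfl fun k _ => hH.re_duhamel_self (hA k) β
  have hcc : ∑ k, (gibbsState β H (A k * (H * A k - A k * H) - (H * A k - A k * H) * A k)).re =
      Zr⁻¹ * ∑ k, ∑ i, ∑ j, m k i j * c i j := by
    rw [mul_sum]
    exact sum_congr rfl fun k _ => hH.re_gibbsState_doubleComm (hA k) β
  rw [hg, hb, hcc]
  -- unnormalised quantities
  set G : ℝ := ∑ k, ∑ i, ∑ j, m k i j * W i with hG
  set B : ℝ := ∑ k, ∑ i, ∑ j, m k i j * K i j with hB
  set C : ℝ := ∑ k, ∑ i, ∑ j, m k i j * c i j with hC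
  -- symmetrised `G`
  have hGsymm : G = ∑ k, ∑ i, ∑ j, m k i j * ((W i + W j) / 2) := by
    have : ∀ k, ∑ i, ∑ j, m k i j * W i = ∑ i, ∑ j, m k i j * W j := by
      intro k
      rw [Finset.sum_comm]
      exact sum_congr rfl fun i _ => sum_congr rfl fun j _ => by rw [hmsymm k j i]
    rw [hG]
    refine sum_congr rfl fun k _ => ?_
    have h2 : ∑ i, ∑ j, m k i j * ((W i + W j) / 2) =
        (∑ i, ∑ j, m k i j * W i + ∑ i, ∑ j, m k i j * W j) / 2 := by
      rw [← sum_add_distrib, Finset.sum_div]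
      refine sum_congr rfl fun i _ => ?_
      rw [← sum_add_distrib, Finset.sum_div]
      refine sum_congr rfl fun j _ => ?_
      ring
    rw [h2, ← this]
    ring
  -- the unnormalised inequality `G² ≤ B · (G + β/4 · C)` by Cauchy–Schwarz over triples
  have hmain : G ^ 2 ≤ B * (G + β / 4 * C) := by
    -- flatten to sums over `ι × n × n`
    set r : ι × n × n → ℝ := fun p => m p.1 p.2.1 p.2.2 * ((W p.2.1 + W p.2.2) / 2) with hr
    set f : ι × n × n → ℝ := fun p => m p.1 p.2.1 p.2.2 * K p.2.1 p.2.2 with hf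
    set g : ι × n × n → ℝ := fun p => m p.1 p.2.1 p.2.2 *
      ((W p.2.1 + W p.2.2) / 2 + β / 4 * c p.2.1 p.2.2) with hgdef
    have hGr : G = ∑ p, r p := by
      rw [hGsymm, hr]
      simp only [Fintype.sum_prod_type]
    have hBf : B = ∑ p, f p := by
      rw [hB, hf]
      simp only [Fintype.sum_prod_type]
    have hGCg : G + β / 4 * C = ∑ p, g p := by
      rw [hGsymm, hC, hgdef]
      simp only [Fintype.sum_prod_type]
      rw [mul_sum, ← sum_add_distrib]
      refine sum_congr rfl fun k _ => ?_
      rw [mul_sum, ← sum_add_distrib]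
      refine sum_congr rfl fun i _ => ?_
      rw [mul_sum, ← sum_add_distrib]
      refine sum_congr rfl fun j _ => ?_
      ring
    rw [hGCg, hGr, hBf]
    refine Finset.sum_sq_le_sum_mul_sum_of_sq_le_mul (univ : Finset (ι × n × n))
      (fun p _ => mul_nonneg (hm0 _ _ _) (hK0 _ _))
      (fun p _ => mul_nonneg (hm0 _ _ _)
        (add_nonneg (by linarith [hW0 p.2.1, hW0 p.2.2]) (mul_nonneg (by linarith) (hc0 _ _))))
      fun p _ => ?_
    -- per pair: `(m·a)² ≤ (m K)(m (a + βc/4))` from `a² ≤ K (a + βc/4)`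
    have hp := sq_half_add_exp_le_duhamelKernel_mul β (E p.2.1) (E p.2.2)
    simp only [hr, hf, hgdef, hK, hc, hW]
    rw [mul_pow]
    have := mul_le_mul_of_nonneg_left hp (mul_nonneg (hm0 p.1 p.2.1 p.2.2) (hm0 p.1 p.2.1 p.2.2))
    nlinarith [this]
  -- normalise by `Zr⁻¹ ≥ 0` (both sides are homogeneous of degree two)
  have hZinv : 0 ≤ Zr⁻¹ := inv_nonneg.2 hZr0
  calc (Zr⁻¹ * G) ^ 2 = Zr⁻¹ * Zr⁻¹ * G ^ 2 := by ring
    _ ≤ Zr⁻¹ * Zr⁻¹ * (B * (G + β / 4 * C)) :=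
        mul_le_mul_of_nonneg_left hmain (mul_nonneg hZinv hZinv)
    _ = Zr⁻¹ * B * (Zr⁻¹ * G + β / 4 * (Zr⁻¹ * C)) := by ring

/-- **Single-observable form**: for Hermitian `A`, with `g = ⟨A²⟩_β`, `b = (A,A)_β`,
`c = ⟨[A,[H,A]]⟩_β` and `β ≥ 0`, `g² ≤ b·(g + (β/4)c)`. [cite: DLS1978, Thm. 3.1] -/
theorem IsHermitian.sq_gibbsState_sq_le_duhamel_mul (hH : H.IsHermitian) {β : ℝ} (hβ : 0 ≤ β)
    {A : Matrix n n ℂ} (hA : A.IsHermitian) :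
    ((gibbsState β H (A * A)).re) ^ 2 ≤
      (duhamel β H A A).re *
        ((gibbsState β H (A * A)).re +
          β / 4 * (gibbsState β H (A * (H * A - A * H) - (H * A - A * H) * A)).re) := by
  have h := falkBruch_sq_sum_le hH hβ (ι := Unit) (A := fun _ => A) fun _ => hA
  simpa using h

/-- **The hyperbolic Falk–Bruch FLOOR on the Duhamel function**: for Hermitian `A` and `β ≥ 0`,

  `(A, A)_β ≥ ⟨A²⟩_β² / (⟨A²⟩_β + (β/4)⟨[A,[H,A]]⟩_β)`,

i.e. `b ≥ g/(1 + u)` with `u = βc/(4g)` — an explicit lower bound on the Duhamel two-point function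
(isothermal susceptibility) by the equal-time second moment and the double commutator, valid also
when the denominator vanishes (then `g = 0` and the right-hand side is `0 ≤ b`).
[cite: DLS1978, Thm. 3.1] -/
theorem IsHermitian.gibbsState_sq_sq_div_le_duhamel (hH : H.IsHermitian) {β : ℝ} (hβ : 0 ≤ β)
    {A : Matrix n n ℂ} (hA : A.IsHermitian) :
    ((gibbsState β H (A * A)).re) ^ 2 /
        ((gibbsState β H (A * A)).re +
          β / 4 * (gibbsState β H (A * (H * A - A * H) - (H * A - A * H) * A)).re) ≤
      (duhamel β H A A).re := by
  have h := hH.sq_gibbsState_sq_le_duhamel_mul hβ hA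
  have hb := hH.re_duhamel_self_nonneg hA β
  have hc := hH.re_gibbsState_doubleComm_nonneg hA hβ
  set g := (gibbsState β H (A * A)).re with hg
  set b := (duhamel β H A A).re
  set c := (gibbsState β H (A * (H * A - A * H) - (H * A - A * H) * A)).re
  -- `g ≥ 0` from the pair-sum form
  have hg0 : 0 ≤ g := by
    rw [hg, hH.re_gibbsState_sq hA β]
    exact mul_nonneg (inv_nonneg.2 (sum_nonneg fun i _ => (Real.exp_pos _).le))
      (sum_nonneg fun i _ => sum_nonneg fun j _ => mul_nonneg (sq_nonneg _) (Real.exp_pos _).le)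
  have hden : 0 ≤ g + β / 4 * c := add_nonneg hg0 (mul_nonneg (by linarith) hc)
  rcases hden.eq_or_lt with hzero | hpos
  · rw [← hzero, div_zero]
    exact hb
  · rw [div_le_iff₀ hpos]
    linarith [h]

end Spectral

end Matrix
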